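import Literature.Probability.FitznerVanDerHofstad2017.NobleJointTwoLevelIotaKit
import Literature.Probability.FitznerVanDerHofstad2017.NobleBoundsN1Cls02
import Literature.Probability.FitznerVanDerHofstad2017.NobleBoundsN1Cls22
import HarnessLib

/-!
# Fitzner–van der Hofstad (2017), §6.1: the class `(a,b) = (0,2)` of (6.4) at `N = 1` for the `ι`-event

[FvdH17] = R. Fitzner, R. van der Hofstad, *Mean-field behavior for nearest-neighbor percolation in `d > 10`*,
Electron. J. Probab. **22** (2017), no. 43, arXiv:1506.07977v2; §6.1 proof of Lemma 5.3 (pp. 58–59):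
"Case `a = 0`" of the `Ξ^ι` start, "Case `a = 0` and `b = 2`" of the middle piece, "`b = 2`" of the last sausage.

The class estimate `h2 (0,2)` of `NobleBoundsN1IotaReduce.tsum_ofReal_nobleXiIotaN_one_le_of_cls₁₂` for the event
`E ι x = NobleJointTwoLevelIota.jointWitIota ι x`:
`J(v−u) ℙ_p^{⊗2}(jointWitIota ∩ class (0,2)) ≤ Σ_κ 𝟙{v = u+e_κ} P^{ι,0}(u,w) Ā'^{κ,0,2}(u,w,t,z) P^{E,2}(t−x,z−x)`.
Only part `I` meets class `a = 0`; on it `w = u`; scalar style (`NobleBoundsN1Cls02` pattern): start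
`{0 ←3→ e_ι} ∘ {e_ι↔u} ∘ {e_ι↔u} ≤ P^{ι,0}(u,u)` (`NobleBoundsN1IotaStart.piPerc_iotaStart_zero_le_blockPiota`), middle
`p · ({v↔t}₁ ∘ {z ←1→ u}₀) ≤ Ā'^{κ,0,2}(u,u,t,z)` (`NobleBoundsN1Cls02.ofReal_mul_piPerc_mid_zero_two_le_blockAbar'`), end
`{x ←1→ t} ∘ {t ←2→ z} ∘ {z ←1→ x} ≤ P^{E,2}` (`NobleBoundsN1Cls22.piPerc_end_two_le_blockPE`).  Unconditional, every
`d` and `p`.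
-/

namespace Literature.Probability.FitznerVanDerHofstad2017

open Literature.Barriers.CriticalPhenomena Literature.Probability.Percolation Literature.Probability.LatticeModels
open Literature.Combinatorics.SimpleGraph _root_.SimpleGraph _root_.MeasureTheory
open Literature.Probability.FitznerVanDerHofstad2017.NobleBlocks
open Literature.Probability.FitznerVanDerHofstad2017.NobleBlocks.LenIdx
open scoped ENNReal BigOperators

variable {d : ℕ}

namespace IotaCls02

/-- The nine upgraded lines of part `I` in class `(0,2)` (`w = u`): level `0`
`{0 ←3→ e}, {e ↔ u}, {u ↔ u}, {z ←1→ u}, {e ↔ u}`; level `1` `{v ↔ t}, {t ←2→ z}, {x ←1→ t}, {z ←1→ x}`.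
[cite: FitznerVanDerHofstad2017, §6.1 "Case a = 0", "Case a = 0 and b = 2", "b = 2" (arXiv:1506.07977v2 p. 59)] -/
def lines (e u z v t x : Site d) : Fin 5 ⊕ Fin 4 → Set (BondConfig (Site d)) :=
  Sum.elim ![event (ge 3) 0 e, event (ge 0) e u, event (ge 0) u u, event (ge 1) z u, event (ge 0) e u]
    ![event (ge 0) v t, event (ge 2) t z, event (ge 1) x t, event (ge 1) z x]

/-- The lines are finitary. [cite: FitznerVanDerHofstad2017, §4.2 Def. 4.1 (arXiv:1506.07977v2 p. 35)] -/
theorem isFinitary_lines (e u z v t x : Site d) : ∀ i, IsFinitary (lines (d := d) e u z v t x i) := by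
  rintro (i | i) <;> fin_cases i
  exacts [isFinitary_event (ge 3) 0 e, isFinitary_event (ge 0) e u, isFinitary_event (ge 0) u u,
    isFinitary_event (ge 1) z u, isFinitary_event (ge 0) e u, isFinitary_event (ge 0) v t,
    isFinitary_event (ge 2) t z, isFinitary_event (ge 1) x t, isFinitary_event (ge 1) z x]

end IotaCls02

open IotaCls02 in
/-- **[FvdH17] §6.1, Case `a = 0, b = 2` of (6.4) at `N = 1` for the `ι`-event.**
`J(v−u) ℙ_p^{⊗2}(jointWitIota ι x u v w z t ∩ class (0,2)) ≤ Σ_κ 𝟙{v = u+e_κ} P^{ι,0}(u,w) Ā'^{κ,0,2}(u,w,t,z) P^{E,2}(t−x,z−x)`.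
[cite: FitznerVanDerHofstad2017, §6.1 proof of Lemma 5.3, "Case a = 0", "Case a = 0 and b = 2", "b = 2" (arXiv:1506.07977v2 pp. 58–59)] -/
theorem jointWitIota_cls_zero_two (p : unitInterval) (ι : Fin d × Bool) (x u v w z t : Site d) :
    ENNReal.ofReal (bondJ d p (v - u)) * piPerc d p 2 (jointWitIota ι x u v w z t ∩ clsSet u w t z 0 2) ≤
      ∑ κ : Fin d × Bool, (if v = u + stepVec κ then (1 : ℝ≥0∞) else 0) *
        (blockPiota (Letters.perc d p) ι 0 u w * blockAbar' (Letters.perc d p) κ 0 2 u w t z *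
          blockPE (Letters.perc d p) 2 (t - x) (z - x)) := by
  classical
  rw [jointWitIota_inter_eq_of_II (jointWitIotaII_inter_clsSet_zero_eq_empty ι x u v w z t 2)]
  refine ofReal_bondJ_mul_le_sum_ite p u v _ _ fun κ hv => ?_
  by_cases hne : (jointWitIotaI ι x u v w z t ∩ clsSet u w t z 0 2).Nonempty
  swap
  · rw [Set.not_nonempty_iff_eq_empty.1 hne, measure_empty, mul_zero]; exact zero_le
  obtain ⟨ω₀, hω₀⟩ := hne
  have hs : JWιSide u v w z t x := (sideI_of_mem hω₀.1).1
  have hzu : z ≠ u := hs.2.2.2.2.2.1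
  obtain ⟨hzx, htx⟩ := ne_and_ne_of_side_of_mem_lineCls hs (by decide) hω₀.2.2
  have hwu : u = w := (mem_lineCls_zero_iff u w 0 ω₀).1 hω₀.2.1
  subst hwu
  have h3 := piPerc_inter_le_prod₃_of_witnessedι p (C := clsSet u u t z 0 2)
    (fun ω (hω : ω ∈ jointWitIotaI ι x u v u z t) => hω.2.2)
    (lines (stepVec ι) u z v t x) (isFinitary_lines _ u z v t x) grpιI grpιI_adm
    (fun ω _ hlat i K hK _ hL hI _ => by
      fin_cases i
      · exact mem_event_ge_three_zero_stepVec hlat hK hL (hI (by decide))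
      · exact mem_openConnGe_zero_of_mem hL
      · exact mem_openConnGe_zero_of_mem hL
      · have hL' : K ∈ (openConn u z : Set (BondConfig (Site d))) := hL
        exact mem_openConnGe_one_of_ne (SimpleGraph.Reachable.symm hL') hzu
      · exact mem_openConnGe_zero_of_mem hL)
    (fun ω hω j K hK _ hL => by
      have h1 := (mem_lineCls_two_iff t z 1 ω).1 hω.2.2
      exact upgrade₁_two h1.1 h1.2 hzx htx j K hK hL)
  refine mul_le_blocks_of_factors h3 ?_ ?_ ?_
  · exact piPerc_grp_le _ _ _ 0 ![Sum.inl 0, Sum.inl 1, Sum.inl 4] (by decide) (by decide)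
      (by funext m; fin_cases m <;> rfl) (piPerc_iotaStart_zero_le_blockPiota p ι u _ rfl)
  · exact mul_piPerc_grp_le _ _ _ _ 1 ![Sum.inr 0, Sum.inl 3] (by decide) (by decide)
      (by funext m; fin_cases m <;> rfl) (ofReal_mul_piPerc_mid_zero_two_le_blockAbar' p hv t z _ (by decide))
  · exact piPerc_grp_le _ _ _ 2 ![Sum.inr 2, Sum.inr 1, Sum.inr 3] (by decide) (by decide)
      (by funext m; fin_cases m <;> rfl) (piPerc_end_two_le_blockPE p hzx htx _)

end Literature.Probability.FitznerVanDerHofstad2017
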